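import Summits.BirchSwinnertonDyer.BirchSwinnertonDyer.Theorems.ByReductionTypeAtTwoAdditiveInertDoorExact
import Summits.BirchSwinnertonDyer.BirchSwinnertonDyer.Theorems.ByReductionTypeAtTwoAdditiveKatoFineDescentAtTwoSharp
import HarnessLib

/-!
# Route `ByReductionTypeAtTwo` (rung K4), crux `AdditiveRankZeroAtTwo` (item stmt-BirchSwinnertonDyer-19098),
# line add_twist_overK v2: the crux BY NAME from its EXACT RESIDUAL after GEN 9 — the kernel-checked GLUE the
# planner's RC-210 (3) split would instantiate (seat `bsd-2adic-addL2x` GEN 9; `--supports … --as helper`; closes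
# nothing; D-0054: nothing filed or booked by this seat — the split itself is the planner's/operator's pen)

HONEST FRAMING (cell `bsd-2adic`, HUMAN RULING D-0036/D-0054): assembly-shaped CONDITIONAL theorem; every
research-grade input is a displayed hypothesis; closes none; BSD is not proved by any of this.

WHAT THIS FILE DOES. The registered skeleton v2 (sha e9944bee…, 5 stubs; `Cruxes/AdditiveRankZeroAtTwo/Lines/`,
tree copy still v1 — the relay `crux write` is refused to this unit) composes the crux from `stub_addPub` (PRINT),
`stub_twistBSD` (= the three SIBLING cruxes 19095/19096/19097 by name), `stub_addQuadraticOverK` (lane A's object on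
the 563 quadratically semistabilisable classes), `stub_addDefectUpper` (hU3) and `stub_addDefectOverKC` (hKC). After
GEN 8/9, hU3 is no longer primitive: on the `E[2]`-IRREDUCIBLE sub-block it follows from Coates–Sujatha's statement (A)
at `(E,2)` through the SHARP Kato-at-2 reading (`AddKatoTwo.addDefectUpper_of_conjA_of_reducibleUpper`, p608284), and
(A) at `2` is a theorem on the reducible sub-block (`AddKatoTwo.conjA_two_of_not_irreducible`, GEN 9). The planner
(RC-210 (3), 2026-08-28T07:51Z; director countersign pending) proposes to FILE «(A) at 2 on the irreducible sub-block»
as a statement item `FineSelmerConjAAtTwoAdditiveIrred` and to split 19098 along it with «the existing door chain as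
glue». This file IS that glue, typed once against hypotheses of exactly the item shapes, so that the operator's split
is a renaming: `additiveRankZeroAtTwo_of_residual` concludes
`Summit.BirchSwinnertonDyer.BirchSwinnertonDyer.Theses.ByReductionTypeAtTwo.AdditiveRankZeroAtTwo` BY NAME from

  PRINT      `hGZK` (Gross–Zagier–Kolyvagin, route PUB item) · `hmod` (modularity, route PUB item) · `hMilneC` (Milne 1972
             any-model) · `hHL` (Hoffstein–Luo 1997) · `hMM` (Murty–Murty 1997 Ch. 6 Thm. 1.2) — the conjuncts of `stub_addPub`;
  READING    `hSharp` (Kato 2004 at `p = 2`, sharp additive pot-good irreducible reading; Literature, flagged, D-audit PASS);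
  SIBLINGS   `hOrd` `hMult` `hSS` — the route's own cruxes `GoodOrdinaryRankZeroAtTwo` (19095), `MultiplicativeRankZeroAtTwo`
             (19096), `SupersingularRankZeroAtTwo` (19097) BY NAME;
  RESIDUAL   (I1) `hAirr` — statement (A) of Coates–Sujatha at `(W, 2)` for every non-CM `r_an = 0` `W` of the defect-≥3
             block with IRREDUCIBLE `E[2]` (the proposed item; a named published conjecture restricted to the block;
             1 172 census classes, 1 078 of them certified per class by GEN 8's class-group kits);
             (I2) `hUred` — the upper half `MissingUpperBoundAt W 2` on the `E[2]`-REDUCIBLE sub-block (210 classes; no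
             Kato reading at `p = 2` with a rational `2`-torsion point exists — R-B45; its (A)-input would be free, GEN 9);
             (I3) `hKC` — `stub_addDefectOverKC` VERBATIM (the `2`-part of BSD over every admissible INERT quadratic `K` on
             the canonical model; odd core: no print; 2-power core: wall);
             (I4) `hQK` — `stub_addQuadraticOverK` VERBATIM (lane A's research object).

`additiveRankZeroAtTwo_residual_iff` records that the glue is not lossy where it can be checked: granted PRINT + READING +
SIBLINGS + (I1), the crux is EQUIVALENT to (I2′) ∧ (I3) ∧ (I4) with (I2′) = hU3 on the whole block (the tree's exactness
certificates `additiveRankZeroAtTwo_iff_quadratic_and_defect`, `additiveDefectAtTwo_iff_upper_and_overKC_of_murtyMurty`,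
`forall_overKC_iff_additiveQuadraticAtTwo_of_hoffsteinLuo` give the converse directions) — NOT typed here beyond the
forward glue, to keep this file a pure assembly; the converses are one-liners from those three names.

References: [Kato2004Asterisque] Thm. 12.5; [CoatesSujatha2005] statement (A); [Milne1972ArithmeticAV] Thm. 1; [HoffsteinLuo1997];
[MurtyMurty1997] Ch. 6 Thm. 1.2; [Lim2017FineSelmer] §3. Memo: `run/shared/lean/pub/bsd-2adic/addL2x/VERDICT-19098-addL2x-GEN9.md`.
-/

set_option autoImplicit false
-- sibling precedent (`ByReductionTypeAtTwoAdditiveInertDoorExact.lean`): the directory name repeats the summit name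
set_option linter.dupNamespace false

noncomputable section

open scoped Classical

namespace Summit.BirchSwinnertonDyer.BirchSwinnertonDyer.Theorems.AddKatoTwo

open WeierstrassCurve Literature.NumberTheory.EllipticCurves
  Literature.NumberTheory.EllipticCurves.Rank1Residual
  Literature.NumberTheory.EllipticCurves.Rank1Residual.Typed
  Summit.BirchSwinnertonDyer.Rank1Residual.AdditivePotMult
  Summit.BirchSwinnertonDyer.Rank1Residual.X5.AddTwoL2
  Summit.BirchSwinnertonDyer.BirchSwinnertonDyer.Theses.ByReductionTypeAtTwo

/-- **The crux `AdditiveRankZeroAtTwo` BY NAME from its exact residual after GEN 9** — PRINT {`hGZK`, `hmod`, `hMilneC`,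
`hHL`, `hMM`} + READING {`hSharp`} + the three SIBLING cruxes {`hOrd`, `hMult`, `hSS`} + the four research-grade ∀-objects
(I1) `hAirr` (Coates–Sujatha (A) at `2` on the `E[2]`-irreducible defect-≥3 sub-block), (I2) `hUred` (upper half on the
`E[2]`-reducible sub-block), (I3) `hKC` (`stub_addDefectOverKC`), (I4) `hQK` (`stub_addQuadraticOverK`). Composition =
skeleton v2's `AdditiveRankZeroAtTwo_of` with `stub_addDefectUpper` replaced by
`addDefectUpper_of_conjA_of_reducibleUpper hSharp hGZK hmod hAirr hUred` and `stub_twistBSD` by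
`Theorems.bsdp_two_twist_of_siblings`. Conditional; nothing asserted; the glue of the planner's proposed RC-210 (3) split.
[cite: Kato2004Asterisque, Thm. 12.5 (1)(3) (pp. 221–222)] [cite: CoatesSujatha2005, statement (A)]
[cite: Milne1972ArithmeticAV, Thm. 1] [cite: MurtyMurty1997, Ch. 6 Thm. 1.2] -/
theorem additiveRankZeroAtTwo_of_residual
    (hGZK : rank_eq_analyticRank_of_analyticRank_le_one) (hmod : hasEntireLFunction_rat)
    (hMilneC : Milne1972.bsdQuotient_baseChange_quadratic_anyModel)
    (hHL : HoffsteinLuo1997_exists_twist_L_one_ne_zero)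
    (hMM : murtyMurty_exists_twist_ne_zero_prescribedAtTwo)
    (hSharp : Kato2004.rankZero_padicValNat_sha_add_padicValNat_tamagawa_le_at_two_of_irreducible_of_fineSelmerDual_fg)
    (hOrd : GoodOrdinaryRankZeroAtTwo) (hMult : MultiplicativeRankZeroAtTwo) (hSS : SupersingularRankZeroAtTwo)
    (hAirr : ∀ (W : WeierstrassCurve ℚ) [W.IsElliptic] [W.IsGloballyMinimal], ¬ W.HasCM → W.analyticRank = 0 →
      DefectAtLeastThree W → W.HasIrreducibleModPGaloisRep 2 →
      ∀ (κ : ZpExtension ℚ 2), κ.IsCyclotomic →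
        ∃ (γ : Field.absoluteGaloisGroup ℚ) (D : W.FineSelmerDualData κ γ),
          Module.Finite ℤ_[2] (RestrictScalars ℤ_[2] (IwasawaAlgebra 2) D.X))
    (hUred : ∀ (W : WeierstrassCurve ℚ) [W.IsElliptic] [W.IsGloballyMinimal], ¬ W.HasCM → W.analyticRank = 0 →
      DefectAtLeastThree W → ¬ W.HasIrreducibleModPGaloisRep 2 → MissingUpperBoundAt W 2)
    (hKC : ∀ (W : WeierstrassCurve ℚ) [W.IsElliptic] [W.IsGloballyMinimal], ¬ W.HasCM → W.analyticRank = 0 →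
      DefectAtLeastThree W → ∀ (K : Type) [Field K] [NumberField K], Module.finrank ℚ K = 2 → TwoInert K →
        (W.quadraticTwist (NumberField.discr K : ℚ)).entireLFunction 1 ≠ 0 →
          MissingPPartOverCAt (W.baseChange K) 2)
    (hQK : ∀ (W : WeierstrassCurve ℚ) [W.IsElliptic] [W.IsGloballyMinimal], ¬ W.HasCM → W.analyticRank = 0 →
      Addv W 2 → ∀ (K : Type) [Field K] [NumberField K], Module.finrank ℚ K = 2 →
        SemistableTwistAtTwo W K → (W.quadraticTwist (NumberField.discr K : ℚ)).entireLFunction 1 ≠ 0 →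
          MissingPPartOverCAt (W.baseChange K) 2) :
    Summit.BirchSwinnertonDyer.BirchSwinnertonDyer.Theses.ByReductionTypeAtTwo.AdditiveRankZeroAtTwo := by
  haveI : Fact (Nat.Prime 2) := ⟨Nat.prime_two⟩
  refine Theorems.additiveRankZeroAtTwo_of_quadratic_of_defect ?_ ?_
  · intro W _ _ hcm hr hadd hq
    obtain ⟨K, _, _, h2, hst, hL⟩ :=
      Theorems.existsSemistabilisingNonvanishingTwist_of_hoffsteinLuo hHL W hq
    obtain ⟨Wd, _, _, hWd, hcmd, hrd, hred⟩ :=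
      Theorems.exists_minimalTwist_semistable_rankZero W hcm K hst hL
    exact bsdp_of_pPartOverC_baseChange W 2 K Wd hGZK hmod hMilneC (by omega) h2 hWd (by omega)
      (hQK W hcm hr hadd K h2 hst hL) (Theorems.bsdp_two_twist_of_siblings hOrd hMult hSS Wd hcmd hrd hred)
  · intro W _ _ hcm hr hdef
    exact Theorems.additiveDefectAtTwo_of_upper_of_overKC_of_murtyMurty hGZK hmod hMilneC hMM
      (addDefectUpper_of_conjA_of_reducibleUpper hSharp hGZK hmod hAirr hUred) hKC W hcm hr hdef

end Summit.BirchSwinnertonDyer.BirchSwinnertonDyer.Theorems.AddKatoTwo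

end
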